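import Summits.Schanuel.Schanuel.Theorems.ZilberEacTransversalLimits
import HarnessLib

/-!
# THEOREM L″, I: the double line substitution and the drift leader

Zilber's Exponential-Algebraic Closedness, case ladder (host summit Schanuel, cell `pub-schanuel`,
seat 2, gen 11).  THEOREM L (`ZilberEacTransversalLimits`) handles solution families escaping along
one fixed direction `q` with CONVERGENT transversal part and convergent power coordinate; it needs
the limit family to be generic INCLUDING the power coordinate.  When the targets' degrees are not
proportional to `q` (invariant-direction regime, `ZilberEacInvariantDirectionDrift`) the transversal
part DRIFTS, `r_m = τ_m d + ρ_m` with `τ_m = log m → ∞`, `ρ_m → ρ₀`, and the power coordinate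
DECAYS super-polynomially (`‖y_m‖^N ‖w_m‖ ≤ 1`).  Then the elimination is again elementary and needs
only the plain Zariski density of the limits `ρ₀`:

* `eval_add_smul_add_smul` — `G(ρ + τ d + y q)` as a polynomial in `Y` over polynomials in `T` over
  `ℂ[ρ]` (double line substitution), `aeval_doubleShift_ne_zero`;
* `norm_sum_range_succ_mul_pow_ge` — quantitative leading-term bound;
* `exists_leader_of_drift` — for `G ≠ 0` a nonzero `g_ℓ ∈ ℂ[ρ]` (the leading `T`-coefficient of the
  leading `Y`-coefficient) such that `g_ℓ(ρ₀) ≠ 0` forces `‖G(r_m + y_m q)‖ ≥ γ > 0` eventually along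
  every family with `r_m - τ_m d → ρ₀`, `τ_m → ∞`, `‖y_m‖/τ_m^k → ∞`;
* (THEOREM L″ itself and its density form are in `ZilberEacDriftingTransversal`.)

HONEST FRAMING: an elimination lemma; `EC(3,2)` OPEN; nothing here bears on Schanuel's conjecture
(EAC ⇏ SC).
-/

noncomputable section

open MvPolynomial Filter Topology Finset Complex
open Literature.NumberTheory.Transcendental Literature.ModelTheory.Zilber

set_option linter.dupNamespace false

namespace Summit.Schanuel.Schanuel.Theorems

/-! ## Part A. The double line substitution `X ↦ X + T d + Y q` -/

section Subst

variable {t : ℕ}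

/-- **Evaluation identity for the double line substitution** `ψ = (C(C Xᵢ + dᵢ T) + qᵢ Y)ᵢ`
(outer variable `Y`, inner variable `T`, coefficients `ℂ[X]`):
`G(ρ + τ d + y q) = ((aeval ψ G).map (eval_τ ∘ map (eval ρ))).eval y`. [folklore] -/
theorem eval_add_smul_add_smul (G : MvPolynomial (Fin t) ℂ) (d q : Fin t → ℂ) (ρ : Fin t → ℂ)
    (τ y : ℂ) :
    eval (ρ + τ • d + y • q) G =
      ((aeval (fun i => Polynomial.C (Polynomial.C (X i) + Polynomial.C (C (d i)) * Polynomial.X) +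
          Polynomial.C (Polynomial.C (C (q i))) * Polynomial.X :
          Fin t → Polynomial (Polynomial (MvPolynomial (Fin t) ℂ))) G).map
        ((Polynomial.evalRingHom τ).comp (Polynomial.mapRingHom (eval ρ)))).eval y := by
  induction G using MvPolynomial.induction_on with
  | C a =>
      rw [aeval_C, Polynomial.algebraMap_apply, Polynomial.algebraMap_apply,
        MvPolynomial.algebraMap_eq, Polynomial.map_C, Polynomial.eval_C, eval_C, RingHom.comp_apply,
        Polynomial.coe_mapRingHom, Polynomial.map_C, eval_C, Polynomial.coe_evalRingHom,
        Polynomial.eval_C]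
  | add p₁ p₂ hp₁ hp₂ => rw [map_add, map_add, Polynomial.map_add, Polynomial.eval_add, hp₁, hp₂]
  | mul_X p i hp =>
      rw [map_mul, map_mul, Polynomial.map_mul, Polynomial.eval_mul, hp, eval_X, aeval_X]
      congr 1
      simp only [Pi.add_apply, Pi.smul_apply, smul_eq_mul, Polynomial.map_add, Polynomial.map_mul,
        Polynomial.map_C, Polynomial.map_X, RingHom.comp_apply, Polynomial.coe_mapRingHom,
        Polynomial.coe_evalRingHom, Polynomial.eval_add, Polynomial.eval_mul, Polynomial.eval_C,
        Polynomial.eval_X, eval_X, eval_C]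
      ring

/-- The substitution recovers `G` at `T = Y = 0`; hence it is nonzero for `G ≠ 0`. [folklore] -/
theorem aeval_doubleShift_ne_zero (G : MvPolynomial (Fin t) ℂ) (hG : G ≠ 0) (d q : Fin t → ℂ) :
    (aeval (fun i => Polynomial.C (Polynomial.C (X i) + Polynomial.C (C (d i)) * Polynomial.X) +
        Polynomial.C (Polynomial.C (C (q i))) * Polynomial.X :
        Fin t → Polynomial (Polynomial (MvPolynomial (Fin t) ℂ))) G) ≠ 0 := by
  intro h0
  apply hG
  apply MvPolynomial.funext
  intro ρ
  rw [map_zero]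
  have h := eval_add_smul_add_smul G d q ρ 0 0
  rw [zero_smul, zero_smul, add_zero, add_zero, h0, Polynomial.map_zero, Polynomial.eval_zero] at h
  exact h

end Subst

/-! ## Part B. Quantitative leading-term bound and the drift leader -/

section Leader

variable {t : ℕ}

/-- If `‖a_d‖ ≥ γ > 0`, `‖a_k‖ ≤ B` (`k < d`), `‖y‖ ≥ 1` and `4 d B ≤ γ ‖y‖`, then
`‖Σ_{k ≤ d} a_k y^k‖ ≥ (γ/2) ‖y‖^d`. [folklore] -/
theorem norm_sum_range_succ_mul_pow_ge {d : ℕ} (a : ℕ → ℂ) {γ B : ℝ} (hγ : 0 < γ) (hB : 0 ≤ B)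
    (hlead : γ ≤ ‖a d‖) (hlow : ∀ k < d, ‖a k‖ ≤ B) {y : ℂ} (hy1 : 1 ≤ ‖y‖)
    (hy : 4 * d * B ≤ γ * ‖y‖) :
    γ / 2 * ‖y‖ ^ d ≤ ‖∑ k ∈ range (d + 1), a k * y ^ k‖ := by
  rw [Finset.sum_range_succ]
  have hypos : 0 < ‖y‖ := by linarith
  have hyd : 0 < ‖y‖ ^ d := pow_pos hypos d
  -- `‖y‖ · ‖lower part‖ ≤ d B ‖y‖^d`
  have hlowsum : ‖y‖ * ‖∑ k ∈ range d, a k * y ^ k‖ ≤ d * B * ‖y‖ ^ d := by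
    have h1 : ‖∑ k ∈ range d, a k * y ^ k‖ ≤ ∑ k ∈ range d, B * ‖y‖ ^ k := by
      refine (norm_sum_le _ _).trans (Finset.sum_le_sum fun k hk => ?_)
      rw [norm_mul, norm_pow]
      exact mul_le_mul_of_nonneg_right (hlow k (Finset.mem_range.1 hk)) (pow_nonneg (norm_nonneg _) _)
    have h2 : ∀ k ∈ range d, ‖y‖ * (B * ‖y‖ ^ k) ≤ B * ‖y‖ ^ d := by
      intro k hk
      have hk' : k + 1 ≤ d := Finset.mem_range.1 hk
      have hpow : ‖y‖ ^ (k + 1) ≤ ‖y‖ ^ d := pow_le_pow_right₀ hy1 hk'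
      rw [pow_succ] at hpow
      nlinarith
    calc ‖y‖ * ‖∑ k ∈ range d, a k * y ^ k‖ ≤ ‖y‖ * ∑ k ∈ range d, B * ‖y‖ ^ k :=
          mul_le_mul_of_nonneg_left h1 (norm_nonneg _)
      _ = ∑ k ∈ range d, ‖y‖ * (B * ‖y‖ ^ k) := by rw [Finset.mul_sum]
      _ ≤ ∑ k ∈ range d, B * ‖y‖ ^ d := Finset.sum_le_sum h2
      _ = d * B * ‖y‖ ^ d := by rw [Finset.sum_const, Finset.card_range, nsmul_eq_mul]; ring
  -- hence `‖lower‖ ≤ (γ/4) ‖y‖^d`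
  have hlow' : ‖∑ k ∈ range d, a k * y ^ k‖ ≤ γ / 4 * ‖y‖ ^ d := by
    have h1 : ‖y‖ * ‖∑ k ∈ range d, a k * y ^ k‖ ≤ ‖y‖ * (γ / 4 * ‖y‖ ^ d) := by
      have hd0 : (0 : ℝ) ≤ d := Nat.cast_nonneg d
      nlinarith [hlowsum]
    exact le_of_mul_le_mul_left h1 hypos
  have htop : γ * ‖y‖ ^ d ≤ ‖a d * y ^ d‖ := by
    rw [norm_mul, norm_pow]
    exact mul_le_mul_of_nonneg_right hlead hyd.le
  have htri : ‖a d * y ^ d‖ ≤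
      ‖∑ k ∈ range d, a k * y ^ k + a d * y ^ d‖ + ‖∑ k ∈ range d, a k * y ^ k‖ := by
    have := norm_sub_le (∑ k ∈ range d, a k * y ^ k + a d * y ^ d) (∑ k ∈ range d, a k * y ^ k)
    rwa [add_sub_cancel_left] at this
  nlinarith [htri, hlow', htop]

/-- **The drift leader.**  For `G ≠ 0` and directions `d, q` there is a nonzero `g_ℓ ∈ ℂ[ρ]` with:
whenever `g_ℓ(ρ₀) ≠ 0`, along EVERY family `x_m = r_m + y_m q` with `r_m - τ_m d → ρ₀`,
`τ_m → +∞` and `‖y_m‖ / τ_m^k → +∞` for all `k`, one has `‖G(x_m)‖ ≥ γ > 0` for all large `m`.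
(new) -/
theorem exists_leader_of_drift (G : MvPolynomial (Fin t) ℂ) (hG : G ≠ 0) (d q : Fin t → ℂ) :
    ∃ gl : MvPolynomial (Fin t) ℂ, gl ≠ 0 ∧ ∀ ρ₀ : Fin t → ℂ, eval ρ₀ gl ≠ 0 →
      ∀ (r : ℕ → Fin t → ℂ) (τ : ℕ → ℝ) (y : ℕ → ℂ),
        Tendsto τ atTop atTop →
        Tendsto (fun m => r m - ((τ m : ℝ) : ℂ) • d) atTop (𝓝 ρ₀) →
        (∀ k : ℕ, Tendsto (fun m => ‖y m‖ / τ m ^ k) atTop atTop) →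
        ∃ γ : ℝ, 0 < γ ∧ ∀ᶠ m in atTop, γ ≤ ‖eval (r m + y m • q) G‖ := by
  classical
  have hexpand : ∀ ρ τ' y', eval (ρ + τ' • d + y' • q) G = _ :=
    fun ρ τ' y' => eval_add_smul_add_smul G d q ρ τ' y'
  have hne := aeval_doubleShift_ne_zero G hG d q
  generalize hGq : (aeval (fun i => Polynomial.C (Polynomial.C (X i) + Polynomial.C (C (d i)) *
      Polynomial.X) + Polynomial.C (Polynomial.C (C (q i))) * Polynomial.X :
      Fin t → Polynomial (Polynomial (MvPolynomial (Fin t) ℂ))) G) = Gq at hexpand hne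
  -- leader: `k* = deg_Y`, `Q = lc_Y`, `j* = deg_T Q`, `gl = lc_T Q`
  obtain ⟨ks, hks⟩ : ∃ ks : ℕ, ks = Gq.natDegree := ⟨_, rfl⟩
  obtain ⟨Q, hQ⟩ : ∃ Q : Polynomial (MvPolynomial (Fin t) ℂ), Q = Gq.leadingCoeff := ⟨_, rfl⟩
  have hQ0 : Q ≠ 0 := by rw [hQ]; exact Polynomial.leadingCoeff_ne_zero.2 hne
  obtain ⟨js, hjs⟩ : ∃ js : ℕ, js = Q.natDegree := ⟨_, rfl⟩
  refine ⟨Q.leadingCoeff, Polynomial.leadingCoeff_ne_zero.2 hQ0, ?_⟩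
  intro ρ₀ hgl r τ y hτ hρ hy
  -- the convergent part `ρ_m`
  obtain ⟨ρs, hρs⟩ : ∃ ρs : ℕ → Fin t → ℂ, ρs = fun m => r m - ((τ m : ℝ) : ℂ) • d := ⟨_, rfl⟩
  have hρs_lim : Tendsto ρs atTop (𝓝 ρ₀) := by rw [hρs]; exact hρ
  have hxm : ∀ m, r m + y m • q = ρs m + ((τ m : ℝ) : ℂ) • d + y m • q := by
    intro m; rw [hρs]; dsimp only; abel
  -- the coefficient arrays and their limits
  obtain ⟨a, ha⟩ : ∃ a : ℕ → ℕ → ℕ → ℂ,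
    a = fun m k j => eval (ρs m) ((Gq.coeff k).coeff j) := ⟨_, rfl⟩
  obtain ⟨aL, haL⟩ : ∃ aL : ℕ → ℕ → ℂ, aL = fun k j => eval ρ₀ ((Gq.coeff k).coeff j) := ⟨_, rfl⟩
  have hakj : ∀ k j, Tendsto (fun m => a m k j) atTop (𝓝 (aL k j)) := fun k j => by
    rw [ha, haL]
    exact ((MvPolynomial.continuous_eval ((Gq.coeff k).coeff j)).tendsto _).comp hρs_lim
  -- `T`-degree bound
  obtain ⟨J, hJ⟩ : ∃ J : ℕ, ∀ k, (Gq.coeff k).natDegree ≤ J := by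
    refine ⟨Gq.support.sup fun k => (Gq.coeff k).natDegree, fun k => ?_⟩
    by_cases hk : k ∈ Gq.support
    · exact Finset.le_sup (f := fun k => (Gq.coeff k).natDegree) hk
    · rw [Polynomial.notMem_support_iff.1 hk, Polynomial.natDegree_zero]; exact Nat.zero_le _
  -- uniform bound on all coefficient values (finitely many)
  set B : ℝ := (∑ k ∈ range (ks + 1), ∑ j ∈ range (J + 1), ‖aL k j‖) + 1 with hB
  have hB0 : 0 ≤ B := by
    have := Finset.sum_nonneg fun k (_ : k ∈ range (ks + 1)) =>
      Finset.sum_nonneg fun j (_ : j ∈ range (J + 1)) => norm_nonneg (aL k j)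
    rw [hB]; linarith
  have hbound : ∀ᶠ m : ℕ in atTop, ∀ k ∈ range (ks + 1), ∀ j ∈ range (J + 1), ‖a m k j‖ ≤ B := by
    have h : ∀ k ∈ range (ks + 1), ∀ j ∈ range (J + 1), ∀ᶠ m : ℕ in atTop, ‖a m k j‖ ≤ B := by
      intro k hk j hj
      have hle : ‖aL k j‖ ≤ ∑ k ∈ range (ks + 1), ∑ j ∈ range (J + 1), ‖aL k j‖ := by
        have h1 : ‖aL k j‖ ≤ ∑ j ∈ range (J + 1), ‖aL k j‖ :=
          Finset.single_le_sum (f := fun j => ‖aL k j‖) (fun _ _ => norm_nonneg _) hj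
        exact h1.trans (Finset.single_le_sum (f := fun k => ∑ j ∈ range (J + 1), ‖aL k j‖)
          (fun _ _ => Finset.sum_nonneg fun _ _ => norm_nonneg _) hk)
      filter_upwards [((hakj k j).norm).eventually (gt_mem_nhds (show ‖aL k j‖ < ‖aL k j‖ + 1 by
        linarith))] with m hm
      rw [hB]; linarith [hm.le]
    have h2 := (Filter.eventually_all_finset (range (ks + 1))).2 fun k hk =>
      (Filter.eventually_all_finset (range (J + 1))).2 fun j hj => h k hk j hj
    filter_upwards [h2] with m hm k hk j hj
    exact hm k hk j hj
  -- coefficients vanish beyond the degree bounds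
  have hzero_j : ∀ m k j, J < j → a m k j = 0 := by
    intro m k j hj
    rw [ha]; dsimp only
    rw [Polynomial.coeff_eq_zero_of_natDegree_lt ((hJ k).trans_lt hj), map_zero]
  -- the leading coefficient value
  set γ₁ : ℝ := ‖eval ρ₀ Q.leadingCoeff‖ with hγ₁
  have hγ₁0 : 0 < γ₁ := norm_pos_iff.2 hgl
  have haLs : aL ks js = eval ρ₀ Q.leadingCoeff := by
    rw [haL, hks, hjs, hQ]; rfl
  have hlead : ∀ᶠ m : ℕ in atTop, γ₁ / 2 ≤ ‖a m ks js‖ := by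
    have h := (hakj ks js).norm
    rw [haLs] at h
    filter_upwards [h.eventually (lt_mem_nhds (show γ₁ / 2 < ‖eval ρ₀ Q.leadingCoeff‖ by
      rw [hγ₁]; linarith))] with m hm
    exact hm.le
  -- ### the estimate
  refine ⟨γ₁ / 16, by positivity, ?_⟩
  have hτ1 : ∀ᶠ m in atTop, (1 : ℝ) ≤ τ m := hτ.eventually_ge_atTop 1
  have hτbig : ∀ᶠ m in atTop, 4 * js * B ≤ γ₁ / 2 * τ m :=
    (hτ.const_mul_atTop (by positivity : (0 : ℝ) < γ₁ / 2)).eventually_ge_atTop _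
  have hybig : ∀ᶠ m in atTop, 16 * ks * ((J + 1) * B) / γ₁ + 1 ≤ ‖y m‖ / τ m ^ J :=
    (hy J).eventually_ge_atTop _
  have hy1 : ∀ᶠ m in atTop, (1 : ℝ) ≤ ‖y m‖ := by
    filter_upwards [(hy 0).eventually_ge_atTop 1] with m hm
    simpa using hm
  filter_upwards [hbound, hlead, hτ1, hτbig, hybig, hy1] with m hbm hlm hτm hτb hyb hym
  have hτ0 : 0 < τ m := by linarith
  have hτJ : (1 : ℝ) ≤ τ m ^ J := one_le_pow₀ hτm
  have hτjs : (1 : ℝ) ≤ τ m ^ js := one_le_pow₀ hτm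
  -- rewrite the value as `Σ_k b_k y^k`
  rw [hxm m, hexpand]
  set φ : Polynomial (MvPolynomial (Fin t) ℂ) →+* ℂ :=
    (Polynomial.evalRingHom ((τ m : ℝ) : ℂ)).comp (Polynomial.mapRingHom (eval (ρs m))) with hφ
  have hφcoeff : ∀ k, φ (Gq.coeff k) = ∑ j ∈ range (J + 1), a m k j * ((τ m : ℝ) : ℂ) ^ j := by
    intro k
    rw [hφ, RingHom.comp_apply, Polynomial.coe_mapRingHom, Polynomial.coe_evalRingHom,
      Polynomial.eval_eq_sum_range' ((Polynomial.natDegree_map_le).trans_lt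
        (Nat.lt_succ_of_le (hJ k)))]
    simp only [Polynomial.coeff_map, ha]
  have hdeg : (Gq.map φ).natDegree < ks + 1 :=
    (Polynomial.natDegree_map_le).trans_lt (by rw [hks]; exact Nat.lt_succ_self _)
  rw [Polynomial.eval_eq_sum_range' hdeg]
  simp only [Polynomial.coeff_map]
  -- level `T`: the top `Y`-coefficient is large
  have hnormτ : ‖((τ m : ℝ) : ℂ)‖ = τ m := by
    rw [Complex.norm_real, Real.norm_eq_abs, abs_of_pos hτ0]
  have htop : γ₁ / 4 * τ m ^ js ≤ ‖φ (Gq.coeff ks)‖ := by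
    rw [hφcoeff]
    -- truncate the `j`-sum at `js + 1` (coefficients above `js` vanish since `deg Q = js`)
    have hjsJ : js ≤ J := by rw [hjs, hQ, Polynomial.leadingCoeff]; exact hJ _
    have hsum : ∑ j ∈ range (J + 1), a m ks j * ((τ m : ℝ) : ℂ) ^ j =
        ∑ j ∈ range (js + 1), a m ks j * ((τ m : ℝ) : ℂ) ^ j := by
      refine (Finset.sum_subset (Finset.range_subset_range.2 (by omega)) fun j hj hj' => ?_).symm
      have hjgt : js < j := by
        rw [Finset.mem_range] at hj hj'; omega
      have : a m ks j = 0 := by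
        rw [ha]; dsimp only
        rw [hks, Polynomial.coeff_natDegree, ← hQ, Polynomial.coeff_eq_zero_of_natDegree_lt
          (by rw [← hjs]; exact hjgt), map_zero]
      rw [this, zero_mul]
    rw [hsum]
    have h := norm_sum_range_succ_mul_pow_ge (fun j => a m ks j) (half_pos hγ₁0) hB0 hlm
      (fun j hj => hbm ks (Finset.mem_range.2 (by omega)) j (Finset.mem_range.2 (by omega)))
      (y := ((τ m : ℝ) : ℂ)) (by rw [hnormτ]; exact hτm) (by rw [hnormτ]; linarith)
    rw [hnormτ] at h
    linarith
  -- level `Y`: lower coefficients are `≤ (J+1) B τ^J`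
  have hlowk : ∀ k < ks, ‖φ (Gq.coeff k)‖ ≤ (J + 1) * B * τ m ^ J := by
    intro k hk
    rw [hφcoeff]
    calc ‖∑ j ∈ range (J + 1), a m k j * ((τ m : ℝ) : ℂ) ^ j‖
        ≤ ∑ j ∈ range (J + 1), B * τ m ^ J := by
          refine (norm_sum_le _ _).trans (Finset.sum_le_sum fun j hj => ?_)
          rw [norm_mul, norm_pow, hnormτ]
          exact mul_le_mul (hbm k (Finset.mem_range.2 (by omega)) j hj)
            (pow_le_pow_right₀ hτm (Nat.lt_succ_iff.1 (Finset.mem_range.1 hj))) (by positivity) hB0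
      _ = (J + 1) * B * τ m ^ J := by
          rw [Finset.sum_const, Finset.card_range, nsmul_eq_mul]; push_cast; ring
  have hcond : 4 * ks * ((J + 1) * B * τ m ^ J) ≤ γ₁ / 4 * τ m ^ js * ‖y m‖ := by
    have h1 : (16 * ks * ((J + 1) * B) / γ₁ + 1) * τ m ^ J ≤ ‖y m‖ := by
      rwa [le_div_iff₀ (by positivity)] at hyb
    have h2 : 16 * ks * ((J + 1) * B) / γ₁ * τ m ^ J ≤ ‖y m‖ := by
      have : 0 ≤ τ m ^ J := by positivity
      nlinarith
    have h3 : 16 * ks * ((J + 1) * B) * τ m ^ J ≤ γ₁ * ‖y m‖ := by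
      have := mul_le_mul_of_nonneg_left h2 hγ₁0.le
      rwa [← mul_assoc, mul_div_cancel₀ _ hγ₁0.ne'] at this
    have h4 : γ₁ * ‖y m‖ ≤ γ₁ * ‖y m‖ * τ m ^ js := le_mul_of_one_le_right (by positivity) hτjs
    nlinarith [h3, h4]
  have h := norm_sum_range_succ_mul_pow_ge (fun k => φ (Gq.coeff k)) (by positivity)
    (by positivity : (0 : ℝ) ≤ (J + 1) * B * τ m ^ J) htop hlowk hym hcond
  have hyks : (1 : ℝ) ≤ ‖y m‖ ^ ks := one_le_pow₀ hym
  calc γ₁ / 16 ≤ γ₁ / 4 * τ m ^ js / 2 * ‖y m‖ ^ ks := by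
        have : γ₁ / 16 ≤ γ₁ / 4 * τ m ^ js / 2 := by nlinarith [hτjs, hγ₁0]
        nlinarith [hyks, this, hγ₁0, hτjs]
    _ ≤ ‖∑ k ∈ range (ks + 1), φ (Gq.coeff k) * y m ^ k‖ := h

end Leader

end Summit.Schanuel.Schanuel.Theorems

end
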